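import Literature.Probability.LatticeModels.GinibreInequalityFiniteSqrtExtension
import Literature.Probability.LatticeModels.PhasesLowerCorrelations
import HarnessLib

/-!
# Phases lower the correlations (Messager–Miracle-Solé–Pfister) for finite abelian groups with a
# square-root extension — cyclic groups `ℤ_p` of every order

The tree's `phasedGinibreExpect_rePhased_le` (`PhasesLowerCorrelations.lean`) proves the
Messager–Miracle-Solé–Pfister inequality `⟨Re(ξχ₀)⟩_{J,u} ≤ ⟨Re χ₀⟩_{J,1}` — phases on the couplings
and on the observable only lower the correlations of a ferromagnetic generalised plane rotator — for
a compact abelian group in which EVERY ELEMENT IS A SQUARE, by the duplication proof of C. Garban,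
T. Spencer, J. Math. Phys. 63 (2022), Appendix Thm. 7.1 [GarbanSpencer2022]: change of variables
`θ = φψ⁻¹`, `θ' = φψ` and positivity of the pulled-back kernel. For finite cyclic groups of even
order the duplication map is not onto; Ginibre's treatment of the discrete case (Comm. Math. Phys.
16 (1970), §2 Example 4, p. 317: «one has to consider separately the two subdomains that consist of
points with both `α` and `β` even multiples or odd multiples of `π/p`. Each subdomain is the product
of identical domains for the variables `α` and `β`») repairs this through the square-root extension
`ℤ_p ⊂ ℤ_{2p}` and the parity blocks, typed in `GinibreInequalityFiniteSqrtExtension.lean`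
(`sum_comp_eq_sum_dupPreimage`, `sum_fibreBlocks_nonneg_of_isPosKernel`). This file runs the SAME
device on the MMP duplicated kernel of the tree (`phasedKernel`, `phased_key`,
`isPosKernel_phasedTrunc`), giving the MMP inequality for every finite abelian `Ω` with an injective
homomorphism `j : Ω → Ω̃` into a finite abelian group in which each `j ω` is a square, for
interaction and observed characters restricted from `Ω̃`:

* `phasedGinibreExpect_rePhased_le_of_sqrtExt`: `⟨Re(ξ χ₀)⟩_{J,u} ≤ ⟨Re χ₀⟩_{J,1}`;
* `abs_phasedGinibreExpect_rePhased_le_of_sqrtExt`, `abs_phasedGinibreExpect_re_mul_le_of_sqrtExt`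
  (`|⟨Re(w χ₀)⟩_{J,u}| ≤ ‖w‖ ⟨Re χ₀⟩_{J,1}`, `w ∈ ℂ`) and, with Ginibre's monotonicity through the
  extension (`ginibreExpect_reChar_mono_of_sqrtExt`), `abs_phasedGinibreExpect_re_mul_le_of_le_of_sqrtExt`
  (`… ≤ ‖w‖ ⟨Re χ₀⟩_{J',1}` for `0 ≤ J ≤ J'`) — the input of Fröhlich's `ℤ_n`-centre domination of
  Wilson loops for EVEN `n` (`Literature.MathematicalPhysics.QuantumFieldTheory.ZnCentreDominatedWilsonLoopsAllN`).

MMP 1978 Prop. 1 is stated for plane rotators and «proved in a much more general framework»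
(arXiv:2311.16546, Remark after Prop. 7.16); Ginibre's Example 4 names the cyclic groups `ℤ_p` of every
order as members of that framework. Everything is PROVED; no named fact. HONEST LABEL: a
finite-volume correlation inequality; nothing here bears on the Yang–Mills mass gap.

## References

* A. Messager, S. Miracle-Solé, C. Pfister, Comm. Math. Phys. 58 (1978) 19–29, Prop. 1.
  [MessagerMiracleSolePfister1978]
* C. Garban, T. Spencer, J. Math. Phys. 63 (2022), Appendix Thm. 7.1. [GarbanSpencer2022]
* J. Ginibre, Comm. Math. Phys. 16 (1970) 310–328, §2 Example 4 (discrete case, p. 316–317).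
  [Ginibre1970]
-/

noncomputable section

open MeasureTheory Filter Finset
open scoped Topology BigOperators

namespace Literature.Probability.LatticeModels

namespace GinibreSqrtExt

/-! ### 1. The MMP duplicated kernel summed over the parity blocks is non-negative -/

section Kernel

variable {Ωt : Type*} [CommGroup Ωt] [TopologicalSpace Ωt] [Fintype Ωt] {Q : Type*}
  [DecidableEq Q] {ι : Type*} [Fintype ι]

/-- The MMP duplicated kernel `2 Im(λχ₀(φ)) Im(λχ₀(ψ)) exp(2∑ Jₐ Re(vₐχₐ(φ)) Re(vₐχₐ(ψ)))` has a
non-negative sum over every union of fibre blocks `{π φ = π ψ ∈ P}`: its truncations are positive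
kernels (`isPosKernel_phasedTrunc`) and converge pointwise. [cite: GarbanSpencer2022, Appendix, proof of Theorem 7.1] -/
theorem sum_fibreBlocks_phasedKernel_nonneg (χ : ι → Ωt →ₜ* Circle) {J : ι → ℝ} (hJ : ∀ a, 0 ≤ J a)
    (v : ι → Circle) (χ₀ : Ωt →ₜ* Circle) (lam : Circle) (π : Ωt → Q) (P : Finset Q) :
    0 ≤ ∑ p ∈ (Finset.univ : Finset (Ωt × Ωt)).filter (fun p => π p.1 = π p.2 ∧ π p.1 ∈ P),
      phasedKernel χ J v χ₀ lam p := by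
  set S := (Finset.univ : Finset (Ωt × Ωt)).filter (fun p => π p.1 = π p.2 ∧ π p.1 ∈ P) with hS
  set T : ℕ → Ωt × Ωt → ℝ := fun N p =>
    2 * (imPhased lam χ₀ p.1 * imPhased lam χ₀ p.2) *
      expTrunc N (2 * ∑ a, J a * (rePhased (v a) (χ a) p.1 * rePhased (v a) (χ a) p.2)) with hT
  have hlim : Tendsto (fun N => ∑ p ∈ S, T N p) atTop (𝓝 (∑ p ∈ S, phasedKernel χ J v χ₀ lam p)) :=
    tendsto_finsetSum _ fun p _ => (tendsto_expTrunc _).const_mul _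
  exact ge_of_tendsto' hlim fun N =>
    sum_fibreBlocks_nonneg_of_isPosKernel (isPosKernel_phasedTrunc χ hJ v χ₀ lam N) π P

end Kernel

/-! ### 2. The set `H = D⁻¹(jΩ × jΩ)` as a union of parity blocks of `Ω̃ / jΩ` -/

section Blocks

variable {Ω Ωt : Type*} [CommGroup Ω] [CommGroup Ωt] [Fintype Ωt]

/-- The preimage `H = {(φ,ψ) : φψ ∈ jΩ, φψ⁻¹ ∈ jΩ}` of `jΩ × jΩ` under the duplication map is the
union over the 2-torsion classes `q` of `Ω̃/jΩ` of the blocks `π⁻¹(q) × π⁻¹(q)` — Ginibre's «both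
even / both odd» subdomains for `ℤ_p ⊂ ℤ_{2p}`. [cite: Ginibre1970, §2 Example 4 (discrete case, p. 317)] -/
theorem filter_dupPreimage_eq_fibreBlocks (j : Ω →* Ωt) [Fintype (Ωt ⧸ j.range)]
    [DecidableEq (Ωt ⧸ j.range)] [DecidablePred fun p : Ωt × Ωt =>
      p.1 * p.2 ∈ Set.range j ∧ p.1 * p.2⁻¹ ∈ Set.range j] :
    (Finset.univ : Finset (Ωt × Ωt)).filter
        (fun p => p.1 * p.2 ∈ Set.range j ∧ p.1 * p.2⁻¹ ∈ Set.range j) =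
      Finset.univ.filter (fun p : Ωt × Ωt => (p.1 : Ωt ⧸ j.range) = (p.2 : Ωt ⧸ j.range) ∧
        (p.1 : Ωt ⧸ j.range) ∈ Finset.univ.filter fun q : Ωt ⧸ j.range => q * q = 1) := by
  refine Finset.filter_congr fun p _ => ?_
  have hr : ∀ x : Ωt, x ∈ Set.range j ↔ x ∈ j.range := fun x => by
    rw [MonoidHom.mem_range, Set.mem_range]
  simp only [hr, Finset.mem_filter, Finset.mem_univ, true_and, QuotientGroup.eq_iff_div_mem,
    div_eq_mul_inv, ← QuotientGroup.mk_mul, QuotientGroup.eq_one_iff]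
  constructor
  · rintro ⟨h1, h2⟩
    refine ⟨h2, ?_⟩
    have h := j.range.mul_mem h1 h2
    rwa [show p.1 * p.2 * (p.1 * p.2⁻¹) = p.1 * p.1 by
      rw [mul_mul_mul_comm, mul_inv_cancel, mul_one]] at h
  · rintro ⟨h2, h1⟩
    refine ⟨?_, h2⟩
    have h := j.range.mul_mem h1 (j.range.inv_mem h2)
    rwa [show p.1 * p.1 * (p.1 * p.2⁻¹)⁻¹ = p.1 * p.2 by
      rw [mul_inv_rev, inv_inv, mul_mul_mul_comm, mul_inv_cancel, mul_one]] at h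

end Blocks

/-! ### 3. The MMP inequality through a square-root extension -/

section Main

variable {Ω : Type*} [CommGroup Ω] [Finite Ω] [TopologicalSpace Ω] [DiscreteTopology Ω]
  [MeasurableSpace Ω] [BorelSpace Ω] {Ωt : Type*} [CommGroup Ωt] [Finite Ωt] [TopologicalSpace Ωt]
  {ι : Type*} [Fintype ι]

/-- A left-invariant measure on a finite group gives all points the same mass. [folklore] -/
private theorem measureReal_singleton_eq' (μ : Measure Ω) [μ.IsMulLeftInvariant] (θ : Ω) :
    μ.real {θ} = μ.real {1} := by
  have hset : (fun h : Ω => θ⁻¹ * h) ⁻¹' ({1} : Set Ω) = {θ} := by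
    ext h
    simp only [Set.mem_preimage, Set.mem_singleton_iff, inv_mul_eq_one]
    exact eq_comm
  rw [measureReal_def, measureReal_def, ← hset,
    ← Measure.map_apply (measurable_of_finite _) (MeasurableSet.singleton (1 : Ω)),
    map_mul_left_eq_self]

/-- **Messager–Miracle-Solé–Pfister through a square-root extension.** Let `Ω` be a finite abelian
group with Haar (uniform) probability measure `μ`, `j : Ω → Ω̃` an injective homomorphism into a
finite abelian group in which every `j ω` is a square, `χₐ = χ̃ₐ ∘ j`, `χ₀ = χ̃₀ ∘ j` restrictions of
unitary characters of `Ω̃`, `Jₐ ≥ 0`, `uₐ ∈ U(1)` phases on the couplings and `ξ ∈ U(1)` a phase on the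
observable. Then `⟨Re(ξ χ₀)⟩_{J,u} ≤ ⟨Re χ₀⟩_{J,1}`. For `Ω = ℤ_p^E ⊂ ℤ_{2p}^E` this is the MMP
inequality for `ℤ_p` clock / gauge models of EVERY order `p` (the tree's
`phasedGinibreExpect_rePhased_le` needs every element of `Ω` to be a square).
[cite: MessagerMiracleSolePfister1978, Prop. 1] [cite: GarbanSpencer2022, Appendix Theorem 7.1] [cite: Ginibre1970, §2 Example 4 (discrete case, p. 316–317)] -/
theorem phasedGinibreExpect_rePhased_le_of_sqrtExt (μ : Measure Ω) [IsProbabilityMeasure μ]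
    [μ.IsMulLeftInvariant] (j : Ω →* Ωt) (hj : Function.Injective j)
    (hsq : ∀ ω : Ω, ∃ s : Ωt, s * s = j ω) (χ : ι → Ω →ₜ* Circle) (χt : ι → Ωt →ₜ* Circle)
    (hχ : ∀ a θ, χ a θ = χt a (j θ)) {J : ι → ℝ} (hJ : ∀ a, 0 ≤ J a) (u : ι → Circle) (ξ : Circle)
    (χ₀ : Ω →ₜ* Circle) (χt₀ : Ωt →ₜ* Circle) (hχ₀ : ∀ θ, χ₀ θ = χt₀ (j θ)) :
    phasedGinibreExpect μ χ J u (rePhased ξ χ₀) ≤ ginibreExpect μ χ J (reChar χ₀) := by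
  classical
  haveI : Fintype Ω := Fintype.ofFinite Ω
  haveI : Fintype Ωt := Fintype.ofFinite Ωt
  -- square roots of the phases
  set v : ι → Circle := fun a => Circle.exp (Complex.arg (u a : ℂ) / 2) with hv
  have huv : (fun a => v a * v a) = u := by
    funext a; rw [hv, ← Circle.exp_add, add_halves, Circle.exp_arg]
  set lam : Circle := Circle.exp (Complex.arg (ξ : ℂ) / 2) with hlam
  have hξ : lam * lam = ξ := by rw [hlam, ← Circle.exp_add, add_halves, Circle.exp_arg]
  rw [← huv, ← hξ]
  set u' : ι → Circle := fun a => v a * v a with hu'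
  have hZ1 : 0 < ∫ θ, ginibreWeight χ J θ ∂μ := integral_exp_pos Integrable.of_finite
  have hZu : 0 < ∫ θ, phasedGinibreWeight χ J u' θ ∂μ := integral_exp_pos Integrable.of_finite
  unfold phasedGinibreExpect ginibreExpect
  rw [div_le_div_iff₀ hZu hZ1]
  -- the duplicated difference (Fubini)
  have hdup := integral_sub_mul_mul_general μ (continuous_reChar χ₀)
    (continuous_rePhased (lam * lam) χ₀) (continuous_ginibreWeight χ J)
    (continuous_phasedGinibreWeight χ J u')
  -- the one-body functions are pulled back from `Ω̃`
  have hre : ∀ θ, reChar χ₀ θ = reChar χt₀ (j θ) := fun θ => by simp only [reChar, hχ₀]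
  have hrp : ∀ θ, rePhased (lam * lam) χ₀ θ = rePhased (lam * lam) χt₀ (j θ) := fun θ => by
    simp only [rePhased, hχ₀]
  have hw1 : ∀ θ, ginibreWeight χ J θ = ginibreWeight χt J (j θ) := fun θ => by
    simp only [ginibreWeight, ginibreHamiltonian, reChar, hχ]
  have hwu : ∀ θ, phasedGinibreWeight χ J u' θ = phasedGinibreWeight χt J u' (j θ) := fun θ => by
    simp only [phasedGinibreWeight, phasedHamiltonian, rePhased, hχ]
  set G : Ωt × Ωt → ℝ := fun y => (reChar χt₀ y.2 - rePhased (lam * lam) χt₀ y.1) *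
    (phasedGinibreWeight χt J u' y.1 * ginibreWeight χt J y.2) with hG
  -- Haar = uniform: the double integral is a positive multiple of the double sum
  have hm : ∀ θ : Ω, μ.real {θ} = μ.real {1} := measureReal_singleton_eq' μ
  have hint : ∫ p : Ω × Ω, (reChar χ₀ p.2 - rePhased (lam * lam) χ₀ p.1) *
        (phasedGinibreWeight χ J u' p.1 * ginibreWeight χ J p.2) ∂(μ.prod μ) =
      μ.real {1} ^ 2 * ∑ θ : Ω × Ω, G (j θ.1, j θ.2) := by
    rw [integral_fintype Integrable.of_finite, Finset.mul_sum]
    refine Finset.sum_congr rfl ?_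
    rintro ⟨θ, θ'⟩ -
    have hμ2 : (μ.prod μ).real {(θ, θ')} = μ.real {1} ^ 2 := by
      rw [measureReal_def, ← Set.singleton_prod_singleton, Measure.prod_prod, ENNReal.toReal_mul,
        ← measureReal_def, ← measureReal_def, hm θ, hm θ', sq]
    rw [hμ2, smul_eq_mul]
    simp only [hG, hre, hrp, hw1, hwu]
  -- the counting change of variables and the parity blocks
  have hcount := sum_comp_eq_sum_dupPreimage j hj hsq G
  haveI : Fintype (Ωt ⧸ j.range) := Fintype.ofFinite _
  have hH := filter_dupPreimage_eq_fibreBlocks j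
  have hkey : ∀ p : Ωt × Ωt, G (dupHom p) = phasedKernel χt J v χt₀ lam p := fun p => by
    simp only [hG, dupHom_apply]
    exact phased_key χt J v χt₀ lam p.1 p.2
  have hpos : 0 ≤ ∑ p ∈ (Finset.univ : Finset (Ωt × Ωt)).filter
      (fun p => p.1 * p.2 ∈ Set.range j ∧ p.1 * p.2⁻¹ ∈ Set.range j), G (dupHom p) := by
    rw [hH, Finset.sum_congr rfl fun p _ => hkey p]
    exact sum_fibreBlocks_phasedKernel_nonneg χt hJ v χt₀ lam (fun x : Ωt => (x : Ωt ⧸ j.range))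
      (Finset.univ.filter fun q : Ωt ⧸ j.range => q * q = 1)
  have hsum : 0 ≤ ∑ θ : Ω × Ω, G (j θ.1, j θ.2) := by
    rw [← hcount] at hpos
    have hc : (0 : ℝ) < ((Finset.univ.filter fun p : Ωt × Ωt => dupHom p = 1).card : ℝ) := by
      exact_mod_cast Finset.card_pos.2 ⟨1, by simp⟩
    exact (mul_nonneg_iff_of_pos_left hc).1 hpos
  have h0 : 0 ≤ (∫ θ, phasedGinibreWeight χ J u' θ ∂μ) * (∫ θ, reChar χ₀ θ * ginibreWeight χ J θ ∂μ) -
      (∫ θ, rePhased (lam * lam) χ₀ θ * phasedGinibreWeight χ J u' θ ∂μ) *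
        (∫ θ, ginibreWeight χ J θ ∂μ) := by
    rw [← hdup, hint]
    exact mul_nonneg (sq_nonneg _) hsum
  linarith

/-- **Two-sided form**: `|⟨Re(ξ χ₀)⟩_{J,u}| ≤ ⟨Re χ₀⟩_{J,1}` (apply the inequality to `ξ` and `−ξ`).
[cite: MessagerMiracleSolePfister1978, Prop. 1] -/
theorem abs_phasedGinibreExpect_rePhased_le_of_sqrtExt (μ : Measure Ω) [IsProbabilityMeasure μ]
    [μ.IsMulLeftInvariant] (j : Ω →* Ωt) (hj : Function.Injective j)
    (hsq : ∀ ω : Ω, ∃ s : Ωt, s * s = j ω) (χ : ι → Ω →ₜ* Circle) (χt : ι → Ωt →ₜ* Circle)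
    (hχ : ∀ a θ, χ a θ = χt a (j θ)) {J : ι → ℝ} (hJ : ∀ a, 0 ≤ J a) (u : ι → Circle) (ξ : Circle)
    (χ₀ : Ω →ₜ* Circle) (χt₀ : Ωt →ₜ* Circle) (hχ₀ : ∀ θ, χ₀ θ = χt₀ (j θ)) :
    |phasedGinibreExpect μ χ J u (rePhased ξ χ₀)| ≤ ginibreExpect μ χ J (reChar χ₀) := by
  refine abs_le.2 ⟨?_, phasedGinibreExpect_rePhased_le_of_sqrtExt μ j hj hsq χ χt hχ hJ u ξ χ₀ χt₀ hχ₀⟩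
  have h := phasedGinibreExpect_rePhased_le_of_sqrtExt μ j hj hsq χ χt hχ hJ u (-ξ) χ₀ χt₀ hχ₀
  have e : rePhased (-ξ) χ₀ = fun θ => -rePhased ξ χ₀ θ := funext fun θ => rePhased_neg ξ χ₀ θ
  rw [e, phasedGinibreExpect_neg] at h
  linarith

/-- **Complex form**: for every `w ∈ ℂ`, `|⟨Re(w χ₀)⟩_{J,u}| ≤ ‖w‖ · ⟨Re χ₀⟩_{J,1}`.
[cite: MessagerMiracleSolePfister1978, Prop. 1] -/
theorem abs_phasedGinibreExpect_re_mul_le_of_sqrtExt (μ : Measure Ω) [IsProbabilityMeasure μ]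
    [μ.IsMulLeftInvariant] (j : Ω →* Ωt) (hj : Function.Injective j)
    (hsq : ∀ ω : Ω, ∃ s : Ωt, s * s = j ω) (χ : ι → Ω →ₜ* Circle) (χt : ι → Ωt →ₜ* Circle)
    (hχ : ∀ a θ, χ a θ = χt a (j θ)) {J : ι → ℝ} (hJ : ∀ a, 0 ≤ J a) (u : ι → Circle) (w : ℂ)
    (χ₀ : Ω →ₜ* Circle) (χt₀ : Ωt →ₜ* Circle) (hχ₀ : ∀ θ, χ₀ θ = χt₀ (j θ)) :
    |phasedGinibreExpect μ χ J u (fun θ => (w * ((χ₀ θ : Circle) : ℂ)).re)| ≤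
      ‖w‖ * ginibreExpect μ χ J (reChar χ₀) := by
  set ξ : Circle := Circle.exp (Complex.arg w) with hξ
  have hw : w = (‖w‖ : ℂ) * (ξ : ℂ) := by
    rw [hξ, Circle.coe_exp]; exact_mod_cast (Complex.norm_mul_exp_arg_mul_I w).symm
  have e : (fun θ => (w * ((χ₀ θ : Circle) : ℂ)).re) = fun θ => ‖w‖ * rePhased ξ χ₀ θ := by
    funext θ
    rw [rePhased, ← Complex.re_ofReal_mul, ← mul_assoc, ← hw]
  rw [e, phasedGinibreExpect_const_mul, abs_mul, abs_norm]
  exact mul_le_mul_of_nonneg_left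
    (abs_phasedGinibreExpect_rePhased_le_of_sqrtExt μ j hj hsq χ χt hχ hJ u ξ χ₀ χt₀ hχ₀) (norm_nonneg w)

/-- **Phases and weaker couplings** (MMP with Ginibre's monotonicity through the extension,
`ginibreExpect_reChar_mono_of_sqrtExt`): for `0 ≤ J ≤ J'`, all phases `u` and `w ∈ ℂ`,
`|⟨Re(w χ₀)⟩_{J,u}| ≤ ‖w‖ · ⟨Re χ₀⟩_{J',1}` — the pointwise bound of Fröhlich's `ℤ_n`-centre comparison,
now for every `n`. [cite: MessagerMiracleSolePfister1978, Prop. 1] [cite: Ginibre1970, §2 Example 4 (discrete case, p. 316–317)] -/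
theorem abs_phasedGinibreExpect_re_mul_le_of_le_of_sqrtExt (μ : Measure Ω) [IsProbabilityMeasure μ]
    [μ.IsMulLeftInvariant] (j : Ω →* Ωt) (hj : Function.Injective j)
    (hsq : ∀ ω : Ω, ∃ s : Ωt, s * s = j ω) (χ : ι → Ω →ₜ* Circle) (χt : ι → Ωt →ₜ* Circle)
    (hχ : ∀ a θ, χ a θ = χt a (j θ)) {J J' : ι → ℝ} (hJ : ∀ a, 0 ≤ J a) (hJJ' : ∀ a, J a ≤ J' a)
    (u : ι → Circle) (w : ℂ) (χ₀ : Ω →ₜ* Circle) (χt₀ : Ωt →ₜ* Circle)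
    (hχ₀ : ∀ θ, χ₀ θ = χt₀ (j θ)) :
    |phasedGinibreExpect μ χ J u (fun θ => (w * ((χ₀ θ : Circle) : ℂ)).re)| ≤
      ‖w‖ * ginibreExpect μ χ J' (reChar χ₀) :=
  (abs_phasedGinibreExpect_re_mul_le_of_sqrtExt μ j hj hsq χ χt hχ hJ u w χ₀ χt₀ hχ₀).trans
    (mul_le_mul_of_nonneg_left
      (ginibreExpect_reChar_mono_of_sqrtExt μ j hj hsq χ χ₀ χt χt₀ hχ hχ₀ hJ hJJ') (norm_nonneg w))

end Main

end GinibreSqrtExt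

end Literature.Probability.LatticeModels

end
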